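import Summits.CriticalPhenomena.PercolationContinuityZ3.Theorems.PercAnnulusCrossingSlabMSFGluing
import Summits.CriticalPhenomena.PercolationContinuityZ3.Theorems.PercAnnulusCrossingSlabMSFAssembly
import Summits.CriticalPhenomena.PercolationContinuityZ3.Theorems.PercNearOneGluingNoHeavyRsw3WMSFeqFMSF
import HarnessLib

/-!
# RSW3 lane: NEWMAN–TASSION–WU 2017, THEOREM 2.4 — the minimal spanning forest of every slab `S_k = ℤ² × {0,…,k}`, `k ≥ 1`,
# is almost surely a single tree (the closer of the sequel build-out; lead GEN 45 with p1 GEN 34)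

builds on p205010 (kernel theorem, internal audit signed; external expert review pending) — NOT used in this file.

Cell `prim-rsw3` (scoping memo `SEQUEL-MSF.md`, GO/NO-GO `SEQUEL-GO-NOGO.md`, blueprint `prim-rsw3-lead/gen44/BUILDOUT-PLAN.md` §6,
file F9; filing table `prim/rsw3/SEQUEL-FILING-ORDER.md`).  Proof file (`--supports stmt-CriticalPhenomena-4575`); no definitions,
no sorries; it DISCHARGES the named facts `Literature.Probability.Percolation.NewmanTassionWu2017_invasionMeet` and
`…NewmanTassionWu2017_thm24` of `SlabMSFStatement.lean` (precedent: `NewmanTassionWu2017_thm31_holds`, p519826).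

The chain (NTW §4 on top of the tree's Theorem 3.1 / Corollary 3.2 at `p_c(S_k)`): the gluing lemma for invasion, Lemma 4.1, in
the form `real_glued_inter_preimage_ge` (`T/…SlabMSFGluing`: the surgery `T/…SlabMSFSurgery` on the landing data
`T/…SlabMSFLanding(W)` / `Lit/SlabMSFLanding`, summed by the tree's Lemma 4.2 `NTW17.labelMeasure_real_le_of_affineRelabel_self`
over the measurable pieces of `T/…SlabMSFPieces`), plugged into the renewal assembly `invasionMeet_of_lemma41`
(`T/…SlabMSFAssembly`: scales from Corollary 3.2 (i),(iii), independence of `C ∩ D′` from the past `T/…SlabMSFIndependence`,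
locality/measurability `T/…SlabMSFMeasurability`, the bound on the modified pairs `T/…SlabMSFPlusCount`, and the renewal lemma
`NTW17.ae_frequently_mem_labelMeasure`), gives §4's statement `NewmanTassionWu2017_invasionMeet` (the invasion clusters of
`0` and `x` meet a.s.); NTW's Proposition 2.3 in the tree's form (`Rsw3.wmsf_reachable_of_common_vertex` with a.s. injective
labels), packaged as `NewmanTassionWu2017.thm24_of_invasionMeet`, gives Theorem 2.4.  Printed-proof repairs used on the way
(lane memo §3): (R0) the blocked-absorption principle for the STOPPED invasion (`Rsw3.openCluster_subset_invasion_exitIndex`),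
(R1) the dual surface taken in `B̄_{m_i} ∖ B̄_{2n_i+1}`, (R2′) Step 2's test read after Steps 1 and 3; none changes the theorem.
Nothing here uses `θ(p_c) = 0` for `ℤ³`.

The paper-literal form `NewmanTassionWu2017_thm24_free` ("the minimal spanning forest on `S_k`": WMSF = FMSF, a single tree) then
follows DETERMINISTICALLY: the free forest contains the wired one (`Rsw3.wmsf_subset_fmsf`) and is acyclic for every labelling
(`isAcyclic_openGraph_fmsf`), so once the wired forest connects all of `S_k` no edge can be added to it inside the free forest
(`wmsf_eq_fmsf_of_forall_reachable`) — in place of NTW's route through [AKN]/[BK] uniqueness and LPS Prop. 3.6.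

References: C. M. Newman, V. Tassion, W. Wu, *Critical percolation and the minimal spanning tree in slabs*, CPAM 70
(2017), arXiv:1512.09107, Theorem 2.4, §2.4, §4 [NewmanTassionWu2017].
-/

noncomputable section

namespace Summit.CriticalPhenomena.PercolationContinuityZ3.Theorems.Crossing

open Literature.Probability.Percolation

/-- **NTW 2017 §4: the invasion clusters of the origin and of any vertex of `S_k` meet almost surely.**
[cite: NewmanTassionWu2017, §4 (proof of Theorem 2.4, pp. 19–21)] -/
theorem NewmanTassionWu2017_invasionMeet_holds : NewmanTassionWu2017_invasionMeet := fun _k hk x =>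
  invasionMeet_of_lemma41 hk
    (fun hp hpb hb1 hn hnN hNM ha hx hs F hF _ ht _ hindep =>
      real_glued_inter_preimage_ge hp hpb hb1 hn hnN hNM ha hx hs F hF ht hindep) x

/-- **A connected wired minimal spanning forest is the free one.**  For every graph and every labelling: `𝔉_w ⊆ 𝔉_f`, `𝔉_f` is
acyclic, so if the graph with edge set `𝔉_w` joins any two vertices then `𝔉_w = 𝔉_f` (an edge of `𝔉_f ∖ 𝔉_w` would close a cycle
of `𝔉_f` with the `𝔉_w`-path between its endpoints). [cite: LyonsPeresSchramm2006, Proposition 3.6 (𝔉_w ⊆ 𝔉_f, with equality iff …; here the trivial direction from connectedness)] -/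
theorem wmsf_eq_fmsf_of_forall_reachable {V : Type*} [DecidableEq V] (G : SimpleGraph V) [G.LocallyFinite]
    (U : Sym2 V → ℝ) (h : ∀ x y : V, (SimpleGraph.fromEdgeSet (wmsf G U)).Reachable x y) :
    wmsf G U = Literature.Barriers.CriticalPhenomena.fmsf G.edgeSet U := by
  refine Set.Subset.antisymm (Rsw3.wmsf_subset_fmsf U) fun e he => ?_
  by_contra hew
  induction e using Sym2.ind with
  | h u v =>
    have huv : u ≠ v := (Literature.Barriers.CriticalPhenomena.mk_mem_fmsf_iff.1 he).2.1
    set F := openGraph (Literature.Barriers.CriticalPhenomena.fmsf G.edgeSet U) with hF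
    have hle : SimpleGraph.fromEdgeSet (wmsf G U) ≤ F :=
      SimpleGraph.fromEdgeSet_mono (Rsw3.wmsf_subset_fmsf U)
    have hadj : F.Adj u v := (openGraph_adj _ u v).2 ⟨he, huv⟩
    have hbridge : F.IsBridge s(u, v) :=
      SimpleGraph.isAcyclic_iff_forall_adj_isBridge.1 (Literature.Barriers.CriticalPhenomena.isAcyclic_openGraph_fmsf _ U) hadj
    obtain ⟨p⟩ := h u v
    have hmem := (SimpleGraph.isBridge_iff_forall_walk_mem_edges.1 hbridge) (p.mapLe hle)
    rw [SimpleGraph.Walk.edges_mapLe_eq_edges] at hmem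
    have := p.edges_subset_edgeSet hmem
    rw [SimpleGraph.edgeSet_fromEdgeSet] at this
    exact hew this.1

/-- **NEWMAN–TASSION–WU 2017, THEOREM 2.4**: for every `k ≥ 1`, the (wired) minimal spanning forest of the slab
`S_k = ℤ² × {0,…,k}` is almost surely a single tree. [cite: NewmanTassionWu2017, Theorem 2.4] -/
theorem NewmanTassionWu2017_thm24_holds : NewmanTassionWu2017_thm24 :=
  NewmanTassionWu2017.thm24_of_invasionMeet NewmanTassionWu2017_invasionMeet_holds

/-- **NEWMAN–TASSION–WU 2017, THEOREM 2.4 as printed** ("For any `k ∈ ℕ`, the minimal spanning forest on `S_k` is a single tree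
a.s.", here `k ≥ 1`): for every `k ≥ 1`, almost surely the wired and free minimal spanning forests of the labelled slab `S_k`
coincide (`𝔉_w = 𝔉_f`, deterministically from `wmsf_eq_fmsf_of_forall_reachable` once `𝔉_w` connects `S_k`) and form a single
tree spanning `S_k`. [cite: NewmanTassionWu2017, Theorem 2.4 (with §2.1: "on S_k, WMSF and FMSF coincide")] -/
theorem NewmanTassionWu2017_thm24_free_holds : NewmanTassionWu2017_thm24_free := by
  intro k hk
  filter_upwards [NewmanTassionWu2017_thm24_holds k hk] with U hU
  exact ⟨wmsf_eq_fmsf_of_forall_reachable (slabGraph 3 k) U hU, hU⟩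

end Summit.CriticalPhenomena.PercolationContinuityZ3.Theorems.Crossing
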